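import Mathlib
import HarnessLib
import Literature.MathematicalPhysics.StatisticalMechanics.StepOperatorBMidUnifTorusFRD
import Literature.MathematicalPhysics.StatisticalMechanics.StepOperatorBSecondDiff
import Literature.MathematicalPhysics.StatisticalMechanics.FluctuationKernelComparisonSecondConnTorusFRD

/-!
# The SECOND-ORDER part of the `ℓ = 2` slot of `B_k` in the tuning parameter, volume-uniform:
# `‖B_{𝒞_{1+q'}}K − 2B_{C̄}K + B_{𝒞_{1+q}}K‖_{k+1,0} ≤ L^d C_{8.7} C ((r₀+1)·27q_H²·(3^{d+1}(2(c₁+1))^d)·(T e^{2KT}K)²) (4^dκ) A⁻¹`,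
# `C̄ = ½(𝒞_{1+q} + 𝒞_{1+q'})` (step data `abkmStepData L R k` of the midpoint kernel FAMILY), `T = Σ|q'−q|`

Twin of `hamNorm_opB_mid_sub_unif_of_torusFRD` (the first-order part of the `ℓ = 2` slot F4b2) for the
genuine second-order part: the triple property on connected polymers is
`tayNormLE_fluct_secondDiff_conn_of_torusFRD`, the operator bound is
`hamNorm_opB_secondDiff_abkm_le_of_stepKernelBounds`, the polynomial polymer factor is absorbed into
`κ' = 4^d κ`.  With `q' = q + 2h`, this bound plus twice the first-order part gives the full line second
difference `B_{q+2h} − 2B_{q+h} + B_q` of [ABKM19] Lemma 12.6 (12.52) with `ℓ = 2`, uniformly in `N`.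

* **`hamNorm_opB_secondDiff_unif_of_torusFRD`**.

## References
* S. Adams, S. Buchholz, R. Kotecký, S. Müller, arXiv:1910.13564, Lemma 8.7, Lemma 12.6 (12.52)
  [AdamsBuchholzKoteckyMuller2019].
* S. Buchholz, J. Funct. Anal. 275 (2018), Thm 4.5 [Buchholz2016].
-/

noncomputable section

namespace Literature.MathematicalPhysics.StatisticalMechanics.GradientRG

open scoped BigOperators
open Real Set Finset MeasureTheory
open Literature.MathematicalPhysics.StatisticalMechanics.GradientFRD
  (fourierCoeff cExt cExt_of_mem IsElliptic IsUnitSymm InShell iterDiff supNorm conv ellOp isElliptic_one)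
open Literature.MathematicalPhysics.StatisticalMechanics.TorusPolymer (IsPolymer numBlocks blockOf boxCorner)
open Literature.Barriers.CriticalPhenomena.LongRangePhi4.Polymer (IsConn)
open Literature.MathematicalPhysics.QuantumFieldTheory

variable {d M : ℕ} [NeZero M]

section Package

variable {L N Mord R n ñ : ℕ} {θbar lam μ δ₁ δ₀ A𝒫 : ℝ}
    {𝒞 : Matrix (Fin d) (Fin d) ℝ → ℕ → (Fin d → ZMod M) → ℝ} {Mc : ℕ → ℝ}
    {Cα : (Fin d → ℕ) → ℕ → ℝ} {c C : ℝ} {Cℓ : ℕ → ℝ}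

set_option maxHeartbeats 3200000 in
/-- **`‖B_{𝒞_{1+q'}}K − 2B_{C̄}K + B_{𝒞_{1+q}}K‖_{k+1,0} ≤ L^d · C_{8.7} · C ℓ⁽²⁾ (4^dκ) A⁻¹` with the `N`-FREE
`ℓ⁽²⁾ = (r₀+1) · 27q_H² · (3^{d+1}(2(c₁+1))^d) · (T e^{2KT} K)²`** (`c₁ = 2(2^d+R) + 2p_Φ + 1`, `T = Σ|q'−q|`),
for symmetric `q, q'` in the ball `Σ|·| ≤ T₀ ≤ ½`, `k + 1 ≤ N`; `C̄ = ½(𝒞_{1+q} + 𝒞_{1+q'})` as a kernel family.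
[cite: AdamsBuchholzKoteckyMuller2019, Lemma 8.7 / Lemma 12.6 (12.52)] -/
theorem hamNorm_opB_secondDiff_unif_of_torusFRD
    (hd : 3 ≤ d) (hMord : 1 ≤ Mord) (hMR : Mord ≤ R) (hLodd : Odd L) (hL : 2 ^ (d + 3) + 16 * R ≤ L)
    (hM : M = L ^ N)
    (hθbar : 0 < θbar) (hlam : 0 < lam) (hn : 2 * Mord ≤ n) (hn2 : 2 ≤ n) (hnñ : n ≤ ñ)
    (hgap : d + 1 ≤ 2 * (ñ - n))
    (hc : 0 < c) (hC1 : 0 ≤ Cℓ 1)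
    (hallA : ∀ A : Matrix (Fin d) (Fin d) ℝ, IsElliptic (1 / 2 : ℝ) 2 A →
        (∀ k, 1 ≤ k → k ≤ N + 1 →
          ∑ x : Fin d → ZMod M, 𝒞 A k x = 0 ∧ ∀ x, 𝒞 A k (-x) = 𝒞 A k x) ∧
        (∀ k, 1 ≤ k → k ≤ N + 1 → ∀ φ : (Fin d → ZMod M) → ℝ, ∑ x, φ x = 0 →
          0 ≤ ∑ x, ∑ y, φ x * 𝒞 A k (x - y) * φ y) ∧
        (∀ φ : (Fin d → ZMod M) → ℝ, ∑ x, φ x = 0 →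
          ellOp A (conv (fun x => ∑ k ∈ Finset.Icc 1 (N + 1), 𝒞 A k x) φ) = φ) ∧
        (∀ k, 1 ≤ k → k ≤ N → Mc k ≤ 0 ∧
          ∀ x : Fin d → ZMod M, ((L : ℝ) ^ k) / 2 ≤ (supNorm x : ℝ) →
            𝒞 A k x = Mc k) ∧
        (∀ k, 1 ≤ k → k ≤ N + 1 → ∀ B : Matrix (Fin d) (Fin d) ℝ, IsUnitSymm B →
          (∃ ε : ℝ, 0 < ε ∧ ∀ x : Fin d → ZMod M,
            ContDiffOn ℝ ⊤ (fun s : ℝ => 𝒞 (A + s • B) k x) (Set.Ioo (-ε) ε)) ∧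
          ∀ α : Fin d → ℕ, ∑ i, α i ≤ n → ∀ ℓ : ℕ, ∀ x : Fin d → ZMod M,
            abs (iteratedDeriv ℓ (fun s : ℝ => iterDiff α (𝒞 (A + s • B) k) x) 0)
              ≤ Cα α ℓ / (L : ℝ) ^ ((k - 1) * (d - 2 + ∑ i, α i))) ∧
        (∀ k, 1 ≤ k → k ≤ N + 1 → ∀ j : ℕ, ∀ κ : Fin d → ZMod M, κ ≠ 0 → InShell L j κ →
          (j < k →
            c / (L : ℝ) ^ (2 * (d + ñ) + 1) * (L : ℝ) ^ (2 * j)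
                / (L : ℝ) ^ ((k - j) * (d - 1 + n)) ≤ (fourierCoeff (𝒞 A k) κ).re ∧
            ‖fourierCoeff (𝒞 A k) κ‖
              ≤ C * (L : ℝ) ^ (2 * (d + ñ) + 1) * (L : ℝ) ^ (2 * j)
                  / (L : ℝ) ^ ((k - j) * (d - 1 + n))) ∧
          (k ≤ j →
            c / (L : ℝ) ^ (2 * (d + ñ) + 1) * (L : ℝ) ^ (2 * k)
                ≤ (fourierCoeff (𝒞 A k) κ).re ∧
            ‖fourierCoeff (𝒞 A k) κ‖ ≤ C * (L : ℝ) ^ (2 * k)) ∧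
          ∀ B : Matrix (Fin d) (Fin d) ℝ, IsUnitSymm B → ∀ ℓ : ℕ, 1 ≤ ℓ →
            (j < k →
              ‖iteratedDeriv ℓ (fun s : ℝ => fourierCoeff (𝒞 (A + s • B) k) κ) 0‖
                ≤ Cℓ ℓ * (L : ℝ) ^ (2 * (d + ñ) + 1) * (L : ℝ) ^ (2 * j)
                    / (L : ℝ) ^ ((k - j) * (d - 1 + ñ))) ∧
            (k ≤ j →
              ‖iteratedDeriv ℓ (fun s : ℝ => fourierCoeff (𝒞 (A + s • B) k) κ) 0‖
                ≤ Cℓ ℓ * (L : ℝ) ^ (2 * k))))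
    (hB : AbkmWeightBounds L N Mord R n θbar lam μ δ₁ δ₀ A𝒫 (fun j => 𝒞 1 j)
      (abkmWeightData L N Mord R θbar (schedDelta δ₀ δ₁ N) fun j => 𝒞 1 j))
    {k : ℕ} (hkN : k + 1 ≤ N) {pT r₀ : ℕ} (hpM : pT + d ≤ Mord) (hr₀ : 3 ≤ r₀) {h A : ℝ} (hh : 0 < h)
    (hA : 1 ≤ A) {ρ : ℝ} (hρ0 : 0 ≤ ρ) (hρ : ρ < θbar)
    {T₀ : ℝ} (hT₀ : T₀ ≤ 1 / 2) (hKT₀ : shellRatioConst c (Cℓ 1) (L : ℝ) d ñ * T₀ ≤ Real.log (1 + ρ))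
    {q q' : Matrix (Fin d) (Fin d) ℝ} (hq : q.IsSymm) (hq' : q'.IsSymm)
    (hqT : ∑ i, ∑ j, |q i j| ≤ T₀) (hq'T : ∑ i, ∑ j, |q' i j| ≤ T₀)
    {p qH ρ'' : ℝ} (hpq : p.HolderConjugate qH) (hρ''0 : 0 ≤ ρ'') (hρ'' : ρ'' < θbar)
    (hpρ : p * (1 + ρ) ≤ 1 + ρ'')
    {K : Finset (Fin d → ZMod M) → ((Fin d → ZMod M) → ℝ) → ℂ} {C : ℝ} (hC : 0 ≤ C)
    (hK : WeakNormLE (abkmNormParams L N Mord R pT r₀ h θbar A (schedDelta δ₀ δ₁ N) fun j => 𝒞 1 j) k K C)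
    (hKd : ∀ X, ContDiff ℝ r₀ (K X))
    (hKloc : ∀ X, IsPolymer (L ^ k) X → IsConn X →
      IsGaugeLocal ((abkmNormParams L N Mord R pT r₀ h θbar A (schedDelta δ₀ δ₁ N) fun j => 𝒞 1 j).gauge k X)
        (K X)) :
    hamNorm (fieldWt h L d (k + 1)) ((L : ℝ) ^ (k + 1)) (L ^ (d * (k + 1)))
        (opB (abkmStepData L R k fun j => 𝒞 ((1 : Matrix (Fin d) (Fin d) ℝ) + q') j) K -
          (2 : ℝ) • opB (abkmStepData L R k fun j x => 2⁻¹ * 𝒞 ((1 : Matrix (Fin d) (Fin d) ℝ) + q) j x +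
            2⁻¹ * 𝒞 ((1 : Matrix (Fin d) (Fin d) ℝ) + q') j x) K +
          opB (abkmStepData L R k fun j => 𝒞 ((1 : Matrix (Fin d) (Fin d) ℝ) + q) j) K) ≤
      (L : ℝ) ^ d * (pi2BoundConst d (((2 * R + 2 : ℕ) : ℝ) + ((d / 2 + 1 : ℕ) : ℝ)) *
        (C * ((r₀ + 1) * (27 * qH ^ 2 *
            (Real.sqrt ((3 : ℝ) ^ (d + 1) * (((2 * ((2 * (2 ^ d + R) + 2 * pT + 1) + 1) : ℕ) : ℝ)) ^ d) *
              ((∑ i, ∑ j, |(q' - q) i j|) *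
                Real.exp (2 * shellRatioConst c (Cℓ 1) (L : ℝ) d ñ * ∑ i, ∑ j, |(q' - q) i j|) *
                shellRatioConst c (Cℓ 1) (L : ℝ) d ñ)) ^ 2)) *
          (((2 : ℝ) ^ d) ^ 2 * weightIntConstRho θbar ρ'' (traceConst d Mord R lam (derivSum d n fun θ' _ => Cα θ' 0)) ^ (1 / p)) *
            A⁻¹)) := by
  set Da := abkmStepData L R k fun j => 𝒞 ((1 : Matrix (Fin d) (Fin d) ℝ) + q') j with hDa
  set Dm := abkmStepData L R k fun j x => 2⁻¹ * 𝒞 ((1 : Matrix (Fin d) (Fin d) ℝ) + q) j x +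
    2⁻¹ * 𝒞 ((1 : Matrix (Fin d) (Fin d) ℝ) + q') j x with hDm
  set Db := abkmStepData L R k fun j => 𝒞 ((1 : Matrix (Fin d) (Fin d) ℝ) + q) j with hDb
  have hk : k + 1 ≤ N + 1 := by omega
  have h1ρ : (1 : ℝ) * (1 + ρ) ≤ 1 + ρ := by rw [one_mul]
  have hSm : StepKernelBounds (abkmWeightData L N Mord R θbar (schedDelta δ₀ δ₁ N) fun j => 𝒞 1 j) L k
      (weightIntConstRho θbar ρ (traceConst d Mord R lam (derivSum d n fun θ' _ => Cα θ' 0)))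
      (secondDiffConst fun θ' => Cα θ' 0) Dm.𝒞 := by
    have h1 := stepKernelBounds_const_mul_convex3_of_torusFRD hd hMord hMR hLodd hL hθbar hlam hn hn2 hnñ hc hC1
      hallA hB hk hρ0 hT₀ hKT₀ hq hq hq' hqT hqT hq'T (p := 1) zero_le_one hρ0 hρ h1ρ
      (a := 2⁻¹) (b := 0) (c₃ := 2⁻¹) (by norm_num) le_rfl (by norm_num) (by norm_num)
    have e : (fun x => (1 : ℝ) * (2⁻¹ * 𝒞 ((1 : Matrix (Fin d) (Fin d) ℝ) + q) (k + 1) x +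
        0 * 𝒞 ((1 : Matrix (Fin d) (Fin d) ℝ) + q) (k + 1) x +
        2⁻¹ * 𝒞 ((1 : Matrix (Fin d) (Fin d) ℝ) + q') (k + 1) x)) = Dm.𝒞 := by
      funext x; simp only [hDm, abkmStepData]; ring
    rw [e, one_mul] at h1
    exact h1
  have hSa : StepKernelBounds (abkmWeightData L N Mord R θbar (schedDelta δ₀ δ₁ N) fun j => 𝒞 1 j) L k _ _ Da.𝒞 :=
    stepKernelBounds_one_add_of_torusFRD hd hMord hMR hLodd hL hθbar hlam hn hn2 hnñ hc hC1 hallA hB hk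
      hρ0 hρ hT₀ hKT₀ hq' hq'T
  have hSb : StepKernelBounds (abkmWeightData L N Mord R θbar (schedDelta δ₀ δ₁ N) fun j => 𝒞 1 j) L k _ _ Db.𝒞 :=
    stepKernelBounds_one_add_of_torusFRD hd hMord hMR hLodd hL hθbar hlam hn hn2 hnñ hc hC1 hallA hB hk
      hρ0 hρ hT₀ hKT₀ hq hqT
  have hA𝒫p : 0 ≤ weightIntConstRho θbar ρ'' (traceConst d Mord R lam (derivSum d n fun θ' _ => Cα θ' 0)) :=
    zero_le_one.trans (one_le_weightIntConstRho hθbar hρ''0 hρ''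
      (traceConst_nonneg d Mord R hlam.le (derivSum_nonneg d n _)))
  set κ := weightIntConstRho θbar ρ'' (traceConst d Mord R lam (derivSum d n fun θ' _ => Cα θ' 0)) ^ (1 / p) with hκdef
  have hκ0 : 0 ≤ κ := Real.rpow_nonneg hA𝒫p _
  set c₁ : ℕ := 2 * (2 ^ d + R) + 2 * pT + 1 with hc₁
  set EK := (∑ i, ∑ j, |(q' - q) i j|) *
    Real.exp (2 * shellRatioConst c (Cℓ 1) (L : ℝ) d ñ * ∑ i, ∑ j, |(q' - q) i j|) *
    shellRatioConst c (Cℓ 1) (L : ℝ) d ñ with hEK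
  have hK0' : 0 ≤ shellRatioConst c (Cℓ 1) (L : ℝ) d ñ := shellRatioConst_nonneg hc hC1 (Nat.cast_nonneg _) d ñ
  have hT0 : 0 ≤ ∑ i, ∑ j, |(q' - q) i j| := sum_nonneg fun _ _ => sum_nonneg fun _ _ => abs_nonneg _
  have hEK0 : 0 ≤ EK := by positivity
  -- the triple property on connected polymers, polynomial factor absorbed into `κ' = 4^d κ`
  refine hamNorm_opB_secondDiff_abkm_le_of_stepKernelBounds hd hLodd hL hM hkN hpM hMR hr₀ hB hh hA Da Dm Db hSa
    hSm hSb (x₀ := 0) rfl rfl rfl rfl rfl rfl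
    (ℓ := (r₀ + 1) * (27 * qH ^ 2 * (Real.sqrt ((3 : ℝ) ^ (d + 1) * (((2 * (c₁ + 1) : ℕ) : ℝ)) ^ d) * EK) ^ 2))
    (κ := ((2 : ℝ) ^ d) ^ 2 * κ) (fun X hX hXc F C0 hC0 hFd hFloc hF => ?_) hC hK hKd hKloc
  have hconn := tayNormLE_fluct_secondDiff_conn_of_torusFRD hd hMord hMR hLodd hL hM hθbar hlam hn hn2 hnñ hgap hc
    hC1 hallA hB hkN hρ0 hρ hT₀ hKT₀ hq hq' hqT hq'T hpq hρ''0 hρ'' hpρ hX hXc hC0 hFd hFloc hF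
    (pT := pT) (r₀ := r₀) (h := h) (A := A)
  refine hconn.mono ?_ (fun φ => ((abkmWeightData L N Mord R θbar (schedDelta δ₀ δ₁ N) fun j => 𝒞 1 j).midWeight_pos k X φ).le)
  set m := numBlocks (L ^ k) X with hm
  have hsq := sqrt_polymerFactor_le d m c₁
  have hmc : 2 * (m + 2 * (2 ^ d + R) + 2 * pT + 1) = 2 * (m + c₁) := by rw [hc₁]; ring
  rw [hmc]
  have hs0 : 0 ≤ Real.sqrt ((3 : ℝ) ^ (d + 1) * (((2 * (m + c₁) : ℕ) : ℝ)) ^ d) * EK := by positivity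
  have hpow : (Real.sqrt ((3 : ℝ) ^ (d + 1) * (((2 * (m + c₁) : ℕ) : ℝ)) ^ d) * EK) ^ 2 ≤
      (Real.sqrt ((3 : ℝ) ^ (d + 1) * (((2 * (c₁ + 1) : ℕ) : ℝ)) ^ d) * EK) ^ 2 * (((2 : ℝ) ^ d) ^ 2) ^ m := by
    have h1 : Real.sqrt ((3 : ℝ) ^ (d + 1) * (((2 * (m + c₁) : ℕ) : ℝ)) ^ d) * EK ≤
        Real.sqrt ((3 : ℝ) ^ (d + 1) * (((2 * (c₁ + 1) : ℕ) : ℝ)) ^ d) * ((2 : ℝ) ^ d) ^ m * EK :=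
      mul_le_mul_of_nonneg_right hsq hEK0
    calc (Real.sqrt ((3 : ℝ) ^ (d + 1) * (((2 * (m + c₁) : ℕ) : ℝ)) ^ d) * EK) ^ 2
        ≤ (Real.sqrt ((3 : ℝ) ^ (d + 1) * (((2 * (c₁ + 1) : ℕ) : ℝ)) ^ d) * ((2 : ℝ) ^ d) ^ m * EK) ^ 2 :=
          pow_le_pow_left₀ hs0 h1 2
      _ = (Real.sqrt ((3 : ℝ) ^ (d + 1) * (((2 * (c₁ + 1) : ℕ) : ℝ)) ^ d) * EK) ^ 2 * (((2 : ℝ) ^ d) ^ 2) ^ m := by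
          ring
  have hq1 : 0 ≤ qH := by linarith [hpq.symm.lt]
  calc C0 * ((r₀ + 1) * (27 * qH ^ 2 * (Real.sqrt ((3 : ℝ) ^ (d + 1) * (((2 * (m + c₁) : ℕ) : ℝ)) ^ d) * EK) ^ 2)) * κ ^ m
      ≤ C0 * ((r₀ + 1) * (27 * qH ^ 2 *
          ((Real.sqrt ((3 : ℝ) ^ (d + 1) * (((2 * (c₁ + 1) : ℕ) : ℝ)) ^ d) * EK) ^ 2 * (((2 : ℝ) ^ d) ^ 2) ^ m))) *
          κ ^ m := by
        gcongr
    _ = C0 * ((r₀ + 1) * (27 * qH ^ 2 * (Real.sqrt ((3 : ℝ) ^ (d + 1) * (((2 * (c₁ + 1) : ℕ) : ℝ)) ^ d) * EK) ^ 2)) *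
          (((2 : ℝ) ^ d) ^ 2 * κ) ^ m := by
        rw [mul_pow]; ring

end Package

end Literature.MathematicalPhysics.StatisticalMechanics.GradientRG

end
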